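import Summits.SmoothPoincare4.SmoothPoincare4.Theorems.SymplecticOrigamiGromovRecognitionRelEndStubTameMoserAux
import HarnessLib

/-!
# Compactly supported Poincaré lemma in degree two on `ℝ⁴`, assembly
(helper for stub `stub_tameMoser`)

Second helper file for stub `stub_tameMoser` of line `cross-cap-laurent` (crux
`GromovRecognitionRelEnd`, item stmt-SmoothPoincare4-11009), continuing
`…StubTameMoserAux` (fibre-integration data `β±`, `q⁺` of a closed compactly supported `2`-form
`τ` on `ℝ⁴`): here the data are assembled into a global compactly supported primitive,

* `exists_primitive_of_fibre_data` — `β = χ · (β⁺ + d(θ(x₀) q⁺))` is a `C^∞` primitive of `τ`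
  with compact support;
* `exists_extDeriv_eq_hasCompactSupport`, `exists_extDeriv_eq_hasCompactSupport'` — **a closed
  `C^∞` `2`-form on `ℝ⁴` with compact support is `dβ` for a `C^∞` `1`-form `β` with compact
  support** (`H²_c(ℝ⁴) = 0`, Bott–Tu (1982), §I.4; the cohomological input of Moser's argument with
  compact support, McDuff–Salamon (2017), §3.2).

Everything is proved; no definition, no named fact.

References: R. Bott, L. W. Tu, *Differential Forms in Algebraic Topology* (1982), §I.4;
D. McDuff, D. Salamon, *Introduction to Symplectic Topology*, 3rd ed. (2017), §3.2.
-/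

noncomputable section

-- the prescribed namespace `Summit.<P>.<Sub>.…` duplicates `SmoothPoincare4` (P = Sub)
set_option linter.dupNamespace false

open scoped Manifold ContDiff Topology
open Set TopologicalSpace Literature.Geometry.Kaehler Literature.Geometry.Symplectic

namespace Summit.SmoothPoincare4.SmoothPoincare4.Theorems.GromovRecognitionRelEnd.CrossCapLaurent

section Assembly

variable {F : Type*} [NormedAddCommGroup F] [NormedSpace ℝ F] {r : ℝ}

/-- The coordinate functions of `ℝ⁴` are continuous. [folklore] -/
theorem continuous_coord (i : Fin 4) : Continuous fun y : EuclideanSpace ℝ (Fin 4) ↦ y i :=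
  (continuous_apply i).comp (PiLp.continuous_ofLp 2 _)

/-- Points of `ℝ⁴` outside the box `{−r − 1 ≤ x₀ ≤ r, |x₁|, |x₂|, |x₃| ≤ r}` (`r ≥ 0`) are detected
by the norm: `‖x‖ > 2r + 1` puts `x` outside the box. [folklore] -/
theorem box_exit_of_norm_gt (hr : 0 ≤ r) {x : EuclideanSpace ℝ (Fin 4)} (hx : 2 * r + 1 < ‖x‖) :
    r < x 0 ∨ x 0 < -r - 1 ∨ ∃ j, j ≠ 0 ∧ r < |x j| := by
  by_contra hcon
  push Not at hcon
  obtain ⟨h0, h0', hj⟩ := hcon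
  have hsq : ‖x‖ ^ 2 = x 0 ^ 2 + x 1 ^ 2 + x 2 ^ 2 + x 3 ^ 2 := by
    rw [EuclideanSpace.real_norm_sq_eq, Fin.sum_univ_four]
  have e0 : x 0 ^ 2 ≤ (r + 1) ^ 2 := by nlinarith
  have e : ∀ j, j ≠ 0 → x j ^ 2 ≤ r ^ 2 := fun j hj0 ↦ by
    have h := abs_le.1 (hj j hj0)
    nlinarith [h.1, h.2]
  have e1 := e 1 one_ne_zero
  have e2 := e 2 (by decide)
  have e3 := e 3 (by decide)
  have hn : (2 * r + 1) ^ 2 < ‖x‖ ^ 2 := by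
    have h2r : 0 ≤ 2 * r + 1 := by linarith
    nlinarith [norm_nonneg x]
  nlinarith

/-- **Assembly of the compactly supported primitive from fibre-integration data** (the output of
`exists_fibre_data`): `β = χ · (β⁺ + d(θ(x₀) q⁺))` with `θ = 1` for `x₀ ≤ −r − 1`, `θ = 0` for
`x₀ ≥ −r − ½` and a cut-off `χ = 1` on the `(2r+2)`-ball, supported in the `(2r+3)`-ball; the form
`β⁺ + d(θ q⁺)` is a primitive of `τ` on the `(2r+4)`-ball which vanishes on the shell
`2r + 1 < ‖x‖ < 2r + 4` (three cases: `x₀ > r`, `x₀ < −r − 1`, `|xⱼ| > r` for some `j ≠ 0`), so `β`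
is a global `C^∞` primitive with compact support. Bott–Tu (1982), §I.4.
[cite: McDuffSalamon2017, §3.2] -/
theorem exists_primitive_of_fibre_data
    {τ : EuclideanSpace ℝ (Fin 4) → EuclideanSpace ℝ (Fin 4) [⋀^Fin 2]→L[ℝ] F}
    (hs : ∀ y, τ y ≠ 0 → ‖y‖ ≤ r) (hr : 0 ≤ r)
    {βp βm : EuclideanSpace ℝ (Fin 4) → EuclideanSpace ℝ (Fin 4) [⋀^Fin 1]→L[ℝ] F}
    {qp : EuclideanSpace ℝ (Fin 4) → EuclideanSpace ℝ (Fin 4) [⋀^Fin 0]→L[ℝ] F}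
    (hβps : ContDiff ℝ ∞ βp) (hqps : ContDiff ℝ ∞ qp)
    (hdp : ∀ x, |x 0| < 2 * r + 4 → extDeriv βp x = τ x)
    (hp1 : ∀ x, r < x 0 → βp x = 0)
    (hp2 : ∀ x, (∃ j, j ≠ 0 ∧ r < |x j|) → βp x = 0)
    (hm1 : ∀ x, x 0 < -r → βm x = 0)
    (hdq : ∀ x, |x 0| < 2 * r + 4 → |x 1| < 2 * r + 4 → extDeriv qp x = βm x - βp x)
    (hq0 : ∀ x, |x 0| < 2 * r + 4 → |x 1| < 2 * r + 4 → (∃ j, j ≠ 0 ∧ r < |x j|) → qp x = 0) :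
    ∃ β : EuclideanSpace ℝ (Fin 4) → EuclideanSpace ℝ (Fin 4) [⋀^Fin 1]→L[ℝ] F,
      ContDiff ℝ ∞ β ∧ extDeriv β = τ ∧ HasCompactSupport β := by
  have hmin : minSmoothness ℝ 2 ≤ ∞ := by
    rw [minSmoothness_of_isRCLikeNormedField]
    exact WithTop.coe_le_coe.2 le_top
  -- the cut-off in `x₀`
  set θ : EuclideanSpace ℝ (Fin 4) → ℝ := fun y ↦ Real.smoothTransition (-2 * (y 0 + r) - 1) with hθ
  have hθs : ContDiff ℝ ∞ θ := by
    refine Real.smoothTransition.contDiff.comp ?_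
    have h0 : ContDiff ℝ ∞ fun y : EuclideanSpace ℝ (Fin 4) ↦ y 0 :=
      (EuclideanSpace.proj (0 : Fin 4) : EuclideanSpace ℝ (Fin 4) →L[ℝ] ℝ).contDiff
    exact ((h0.add contDiff_const).const_smul (-2 : ℝ)).sub contDiff_const
  have hθ1 : ∀ y : EuclideanSpace ℝ (Fin 4), y 0 < -r - 1 → θ y = 1 := fun y hy ↦
    Real.smoothTransition.one_of_one_le (by linarith)
  have hθ0 : ∀ y : EuclideanSpace ℝ (Fin 4), r < y 0 → θ y = 0 := fun y hy ↦
    Real.smoothTransition.zero_of_nonpos (by linarith)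
  set γ : EuclideanSpace ℝ (Fin 4) → EuclideanSpace ℝ (Fin 4) [⋀^Fin 0]→L[ℝ] F :=
    fun y ↦ θ y • qp y with hγ
  have hγs : ContDiff ℝ ∞ γ := hθs.smul hqps
  set β₀ : EuclideanSpace ℝ (Fin 4) → EuclideanSpace ℝ (Fin 4) [⋀^Fin 1]→L[ℝ] F :=
    fun y ↦ βp y + extDeriv γ y with hβ₀
  have hβ₀s : ContDiff ℝ ∞ β₀ := hβps.add (contDiff_extDeriv hγs)
  have habs : ∀ (y : EuclideanSpace ℝ (Fin 4)) (i : Fin 4), |y i| ≤ ‖y‖ := fun y i ↦ by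
    simpa only [Real.norm_eq_abs] using PiLp.norm_apply_le y i
  have hU : ∀ y : EuclideanSpace ℝ (Fin 4), ‖y‖ < 2 * r + 4 →
      |y 0| < 2 * r + 4 ∧ |y 1| < 2 * r + 4 := fun y hy ↦
    ⟨(habs y 0).trans_lt hy, (habs y 1).trans_lt hy⟩
  -- `dβ₀ = τ` on the `(2r+4)`-ball
  have hdβ₀ : ∀ x : EuclideanSpace ℝ (Fin 4), ‖x‖ < 2 * r + 4 → extDeriv β₀ x = τ x := by
    intro x hx
    rw [hβ₀, extDeriv_fun_add (hβps.differentiable (by simp) x)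
      ((contDiff_extDeriv hγs).differentiable (by simp) x), hdp x (hU x hx).1,
      extDeriv_extDeriv_apply hγs.contDiffAt hmin, add_zero]
  -- `β₀` vanishes near the points of the `(2r+4)`-ball outside the box
  have hvan : ∀ x : EuclideanSpace ℝ (Fin 4), ‖x‖ < 2 * r + 4 →
      (r < x 0 ∨ x 0 < -r - 1 ∨ ∃ j, j ≠ 0 ∧ r < |x j|) → ∀ᶠ y in 𝓝 x, β₀ y = 0 := by
    intro x hx hcase
    have hball : ∀ᶠ y in 𝓝 x, ‖y‖ < 2 * r + 4 :=
      (isOpen_lt continuous_norm continuous_const).mem_nhds hx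
    rcases hcase with h | h | ⟨j, hj, h⟩
    · have hopen : ∀ᶠ y in 𝓝 x, r < y 0 :=
        (isOpen_lt continuous_const (continuous_coord 0)).mem_nhds h
      have hγ0 : ∀ᶠ y in 𝓝 x, γ y = 0 := hopen.mono fun y hy ↦ by
        rw [hγ]; dsimp only; rw [hθ0 y hy, zero_smul]
      filter_upwards [hopen, hγ0.eventually_nhds] with y hy hγy
      rw [hβ₀]; dsimp only
      rw [hp1 y hy, extDeriv_eq_zero_of_eventuallyEq_zero hγy, add_zero]
    · have hopen : ∀ᶠ y in 𝓝 x, y 0 < -r - 1 :=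
        (isOpen_lt (continuous_coord 0) continuous_const).mem_nhds h
      have hγq : ∀ᶠ y in 𝓝 x, γ y = qp y := hopen.mono fun y hy ↦ by
        rw [hγ]; dsimp only; rw [hθ1 y hy, one_smul]
      filter_upwards [hopen, hball, hγq.eventually_nhds] with y hy hyb hγy
      rw [hβ₀]; dsimp only
      rw [Filter.EventuallyEq.extDeriv_eq (hγy : γ =ᶠ[𝓝 y] qp), hdq y (hU y hyb).1 (hU y hyb).2,
        add_sub_cancel, hm1 y (by linarith)]
    · have hopen : ∀ᶠ y in 𝓝 x, r < |y j| :=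
        (isOpen_lt continuous_const (continuous_coord j).abs).mem_nhds h
      have hγ0 : ∀ᶠ y in 𝓝 x, γ y = 0 := by
        filter_upwards [hopen, hball] with y hy hyb
        rw [hγ]; dsimp only
        rw [hq0 y (hU y hyb).1 (hU y hyb).2 ⟨j, hj, hy⟩, smul_zero]
      filter_upwards [hopen, hγ0.eventually_nhds] with y hy hγy
      rw [hβ₀]; dsimp only
      rw [hp2 y ⟨j, hj, hy⟩, extDeriv_eq_zero_of_eventuallyEq_zero hγy, add_zero]
  -- the global cut-off
  obtain ⟨χ, hχs, hχ1, hχ0⟩ := exists_contDiff_one_nhdsSet_of_isCompact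
    (isCompact_closedBall (0 : EuclideanSpace ℝ (Fin 4)) (2 * r + 2)) Metric.isOpen_ball
    (Metric.closedBall_subset_ball (by linarith : 2 * r + 2 < 2 * r + 3))
  refine ⟨fun y ↦ χ y • β₀ y, hχs.smul hβ₀s, ?_, ?_⟩
  · funext x
    rcases le_or_gt ‖x‖ (2 * r + 2) with hx | hx
    · have h1 : ∀ᶠ y in 𝓝 x, χ y = 1 :=
        hχ1.filter_mono (nhds_le_nhdsSet (Metric.mem_closedBall.2 (by simpa using hx)))
      have heq : (fun y ↦ χ y • β₀ y) =ᶠ[𝓝 x] β₀ := h1.mono fun y hy ↦ by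
        simp only [hy, one_smul]
      rw [heq.extDeriv_eq, hdβ₀ x (by linarith)]
    · have hτ0 : τ x = 0 := by
        by_contra h
        linarith [hs x h]
      rw [hτ0]
      apply extDeriv_eq_zero_of_eventuallyEq_zero
      rcases lt_or_ge ‖x‖ (2 * r + 3) with hx' | hx'
      · exact (hvan x (by linarith) (box_exit_of_norm_gt hr (by linarith))).mono fun y hy ↦ by
          rw [hy, smul_zero]
      · have hxc : x ∈ (Metric.ball (0 : EuclideanSpace ℝ (Fin 4)) (2 * r + 3))ᶜ := fun h ↦ by
          rw [Metric.mem_ball, dist_zero_right] at h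
          linarith
        exact (hχ0.filter_mono (nhds_le_nhdsSet hxc)).mono fun y hy ↦ by rw [hy, zero_smul]
  · refine HasCompactSupport.intro (isCompact_closedBall (0 : EuclideanSpace ℝ (Fin 4)) (2 * r + 3))
      fun x hx ↦ ?_
    have hx' : x ∈ (Metric.ball (0 : EuclideanSpace ℝ (Fin 4)) (2 * r + 3))ᶜ := fun h ↦
      hx (Metric.ball_subset_closedBall h)
    have h0 : χ x = 0 := (hχ0.filter_mono (nhds_le_nhdsSet hx')).self_of_nhds
    simp only [h0, zero_smul]

/-- **Poincaré lemma with compact support in degree two on `ℝ⁴`** (`H²_c(ℝ⁴) = 0`; Bott–Tu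
(1982), §I.4, Cor. 4.7.1; the cohomological input of the compactly supported Moser argument,
McDuff–Salamon (2017), §3.2): a closed `C^∞` `2`-form on `ℝ⁴` (values in a complete space)
supported in a ball is the exterior derivative of a `C^∞` `1`-form with compact support.
[cite: McDuffSalamon2017, §3.2] -/
theorem exists_extDeriv_eq_hasCompactSupport [CompleteSpace F]
    {τ : EuclideanSpace ℝ (Fin 4) → EuclideanSpace ℝ (Fin 4) [⋀^Fin 2]→L[ℝ] F}
    (hτ : ContDiff ℝ ∞ τ) (hd : extDeriv τ = 0) (hs : ∀ y, τ y ≠ 0 → ‖y‖ ≤ r) :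
    ∃ β : EuclideanSpace ℝ (Fin 4) → EuclideanSpace ℝ (Fin 4) [⋀^Fin 1]→L[ℝ] F,
      ContDiff ℝ ∞ β ∧ extDeriv β = τ ∧ HasCompactSupport β := by
  wlog hr : 0 ≤ r generalizing r
  · refine this (r := 0) (fun y hy ↦ ?_) le_rfl
    exact absurd ((norm_nonneg y).trans (hs y hy)) (not_le.2 (lt_of_not_ge hr))
  obtain ⟨βp, βm, qp, hβps, -, hqps, hdp, hp1, hp2, hm1, hdq, hq0⟩ := exists_fibre_data hτ hd hs hr
  exact exists_primitive_of_fibre_data hs hr hβps hqps hdp hp1 hp2 hm1 hdq hq0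

/-- The same with the hypothesis `HasCompactSupport τ`. [cite: McDuffSalamon2017, §3.2] -/
theorem exists_extDeriv_eq_hasCompactSupport' [CompleteSpace F]
    {τ : EuclideanSpace ℝ (Fin 4) → EuclideanSpace ℝ (Fin 4) [⋀^Fin 2]→L[ℝ] F}
    (hτ : ContDiff ℝ ∞ τ) (hd : extDeriv τ = 0) (hs : HasCompactSupport τ) :
    ∃ β : EuclideanSpace ℝ (Fin 4) → EuclideanSpace ℝ (Fin 4) [⋀^Fin 1]→L[ℝ] F,
      ContDiff ℝ ∞ β ∧ extDeriv β = τ ∧ HasCompactSupport β := by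
  obtain ⟨r, hr⟩ := hs.isCompact.isBounded.subset_closedBall 0
  refine exists_extDeriv_eq_hasCompactSupport hτ hd (r := r) fun y hy ↦ ?_
  have h := hr (subset_tsupport _ (Function.mem_support.2 hy))
  rwa [Metric.mem_closedBall, dist_zero_right] at h

/-- **Registered helper sub-goal `helper_poincareCompactSupport`** (the case `F = ℝ` of
`exists_extDeriv_eq_hasCompactSupport'`, one-line form): `H²_c(ℝ⁴) = 0` for real-valued
Mathlib forms. [cite: McDuffSalamon2017, §3.2] -/
theorem helper_poincareCompactSupport :
    ∀ (τ : EuclideanSpace ℝ (Fin 4) → EuclideanSpace ℝ (Fin 4) [⋀^Fin 2]→L[ℝ] ℝ),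
    ContDiff ℝ ∞ τ → extDeriv τ = 0 → HasCompactSupport τ →
    ∃ β : EuclideanSpace ℝ (Fin 4) → EuclideanSpace ℝ (Fin 4) [⋀^Fin 1]→L[ℝ] ℝ,
      ContDiff ℝ ∞ β ∧ extDeriv β = τ ∧ HasCompactSupport β :=
  fun _ hτ hd hs ↦ exists_extDeriv_eq_hasCompactSupport' hτ hd hs

end Assembly

end Summit.SmoothPoincare4.SmoothPoincare4.Theorems.GromovRecognitionRelEnd.CrossCapLaurent

end
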